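import Literature.Geometry.Kaehler.ComplexTorusLefschetzSL2ActionPoincareAdjoint
import HarnessLib

/-!
# Looijenga–Lunts' form `φ(α, β) = (−1)^q ∫ α ∪ β` (`deg α = g + 2q` or `g + 2q + 1`) is INVARIANT under Beauville's `SL₂(ℂ)`:
# `Σ_m (−1)^{⌊(m−g)/2⌋} ⟨(ρ(γ) x)_m, (ρ(γ) y)_{2g−m}⟩ = (−1)^{⌊(k−g)/2⌋} ⟨x, y⟩` for `x ∈ Hᵏ`, `y ∈ H^{2g−k}`, every `γ ∈ SL₂(ℂ)`

Layer `Literature/Geometry/Kaehler`, namespace `Literature.Geometry.Kaehler.ComplexTorus`; lane `lit-hodgefound` (Track 2 foundations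
library), prover seat `lit-hodgefound-p09` (generation 53, row g53-#5). THEOREMS ONLY (no definition, no named fact, no instance, no
notation; D-0026 net debt `0`). Sequel of row g52-#10 `ComplexTorusLefschetzSL2ActionPoincareAdjoint` (for the untwisted cup-product pairing
`⟨x, y⟩_e = poincarePairing Φ e h x y`: `H` skew, `L_η`, `Λ_η`, `w` self-adjoint, hence only the TWISTED isometry
`Σ_m ⟨(ρ(γ) x)_m, (ρ(DγD) y)_{2g−m}⟩ = ⟨x, y⟩`, `D = diag(1, −1)`), of g52-#3 `ComplexTorusWeylOperatorPoincareSelfAdjoint`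
(`poincarePairing_countingG_skew`, `poincarePairing_lefschetzPow_one_comm`) and of the abstract row
`Algebra/Lie/LefschetzModuleSL2RepresentationFunctoriality` §InvariantForm (**`sl2Rep_isOrthogonal`**: if `h` AND `e` are skew for a bilinear
form `φ`, every `ρ(γ)` is a `φ`-isometry — Looijenga–Lunts (1.3) integrated).

THE POINT. Looijenga–Lunts equip `M = H•(X)[n]` with the SIGN-TWISTED intersection form "`φ(α, β) := (−1)^q ∫_X α ∪ β` if `α` is homogeneous of
degree `n + 2q` or `n + 2q + 1`" (1.7); the twist `ε(k) = (−1)^{⌊(k−n)/2⌋}` satisfies `ε(k + 2) = −ε(k)`, which turns the cup-product-self-adjoint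
`L_η` into a `φ`-SKEW operator while `h` stays `φ`-skew; by (1.3)/(1.6) "`𝔤(𝔞, M)` is then a subalgebra of `aut(M, φ)`", "preserves `φ`
infinitesimally", and at GROUP level Beauville's `ρ(SL₂(ℂ))` (generated by `exp(a L_η)`, `exp(a Λ_η)`) preserves `φ` on the nose — no outer
twist `D`. This is the `SL₂`-invariant pairing on the cohomology of a polarised complex torus (menu item "Mukai pairing" of this seat's
generation 52, settled with Looijenga–Lunts' printed sign convention).

SETTING. `X = E/Φ(ℤ^ι)`, `e : Fin N ≃ ι` a lattice frame (`N = 2g`, `g = dim_ℂ E`), `⟨x, y⟩_e = poincarePairing Φ e h x y` (`x ∈ Hᵏ`, `y ∈ Hˡ`,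
`h : k + l = N`), `ρ = (hasLefschetzProperty_lefschetzG hη).sl2Rep isZGrading_countingG` (`η` non-degenerate), `w` its Weyl operator, and the
Looijenga–Lunts sign `ε(k) = (−1)^{⌊(k−g)/2⌋}` written `(-1 : ℂ) ^ (((k : ℤ) - g) / 2)` (integer division = floor for the divisor `2`).

## What is proved

* §0 (private packaging, as in g52-#10) the graded form `B_φ(w, w') = Σ_{k+l=N} ε(k) ⟨w_k, w'_l⟩_e` with **`h` and `L_η` BOTH `B_φ`-skew**
  (`ε(k + 2) = −ε(k)`, `neg_one_zpow_div_two_add_two`).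
* §1 **`sum_llSign_mul_poincarePairing_sl2Rep_sl2Rep_eq`: `Σ_{m ≤ N} ε(m) ⟨(ρ(γ)(of k x))_m, (ρ(γ)(of l y))_{N−m}⟩_e = ε(k) ⟨x, y⟩_e`**
  (`k + l = N`) for EVERY `γ ∈ SL₂(ℂ)` — `φ(ρ(γ) x, ρ(γ) y) = φ(x, y)`; `sum_llSign_mul_poincarePairing_sl2Rep_sl2Rep_eq_zero` (`k + l ≠ N`:
  the total is `0 = φ(x, y)`); the Weyl operator / normalised Fourier transform as a `φ`-isometry:
  `sum_llSign_mul_poincarePairing_weylOperator_weylOperator_eq` and, since `w` is homogeneous, **`llSign_mul_poincarePairing_weylOperator_weylOperator`: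
  `ε(2g − k) ⟨w(x)_{2g−k}, w(y)_{2g−l}⟩_e = ε(k) ⟨x, y⟩_e`**.

## Sources, VERBATIM

* E. Looijenga, V. A. Lunts, *A Lie algebra attached to a projective variety*, Invent. Math. 129 (1997) [LooijengaLunts1997] (held text
  `paper:arxiv-alg-geom_9604014`), §1 (1.7) p0006: "Let `X` be a compact Kählerian manifold of dimension `n`. We take for `M` its shifted total
  complex cohomology `H(X)[n]` and we let `φ` be defined by `φ(α, β) := (−1)^q ∫_X α ∪ β` if `α` is homogeneous of degree `n + 2q` or `n + 2q + 1`.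
  […] `φ` together with cupping with a Kähler class defines a polarization of `M`. So by proposition 1.6 `H(X)[n]` is a Lefschetz module over
  `H²(X)`"; (1.6) Proposition p0005: "`𝔤(𝔞, M)` is a semisimple Lie algebra defined over `ℝ` that preserves `φ` infinitesimally. Proof. […] If
  we regard `φ` as an element of `M^* ⊗ M^*` of degree zero, then the fact that `φ` is killed by `e_a` implies that it is killed by `f_a`";
  (1.3) p0005: "So `𝔤(𝔞, M)` is then a subalgebra of `aut(M, φ)`".
* A. Beauville, *The action of SL₂ on abelian varieties*, J. Ramanujan Math. Soc. 25 (2010) [Beauville2010SL2], §4 Theorem (the action: `exp(aL)`,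
  `exp(aΛ)`, `ℱ`, `n^{−g} n^*`).
* Y. André, *Pour une théorie inconditionnelle des motifs* (1996) [Andre1996Motifs], §1.1–§1.2 (p. 11) ("`L` […] auto-adjoint" for `∫ x ∪ y`).
* H. Lange, *Abelian Varieties over the Complex Numbers* (2023) [Lange2023AbelianVarietiesComplex], §1.4.1 (p. 37, the cup-product pairing).

## Scope

Cohomological carrier only; the sign is Looijenga–Lunts' (first argument, `q = ⌊(deg − g)/2⌋`); no comparison with Mukai's / Huybrechts'
K3-type Mukai pairing conventions is made. The infinitesimal statements for `L_η`, `Λ_η` alone are g52-#3's cup-product self-adjointness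
read with the sign `ε` and are not restated.
-/

noncomputable section

-- `Module ℂ` / `SMulZeroClass ℂ` synthesis on `E [⋀^Fin k]→L[ℝ] ℂ` (as in `ComplexTorusLefschetzDecomposition`)
set_option maxSynthPendingDepth 3

namespace Literature.Geometry.Kaehler

namespace ComplexTorus

open Module Function Finset
open scoped MatrixGroups
open Literature.LinearAlgebra.Alternating Literature.Algebra.Lie

universe uE

variable {ι : Type*} [Fintype ι] [DecidableEq ι] {E : Type uE} [NormedAddCommGroup E] [NormedSpace ℂ E] [FiniteDimensional ℂ E]
  [Nontrivial E] (Φ : (ι → ℝ) ≃L[ℝ] E) {η : E [⋀^Fin 2]→L[ℝ] ℝ} {N : ℕ}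

/-! ## §0 Looijenga–Lunts' graded form `B_φ = Σ_{k+l=N} ε(k) ⟨·_k, ·_l⟩_e` (private packaging) -/

section Graded

omit [Fintype ι] [DecidableEq ι] [NormedAddCommGroup E] [NormedSpace ℂ E] [FiniteDimensional ℂ E] [Nontrivial E] in
/-- **`ε(k + 2) = −ε(k)`** for `ε(k) = (−1)^{⌊(k−g)/2⌋}` (the degree-`2` operators flip Looijenga–Lunts' sign). [cite: LooijengaLunts1997, §1 (1.7) p. 6] -/
theorem neg_one_zpow_div_two_add_two (k : ℤ) (g : ℤ) : (-1 : ℂ) ^ ((k + 2 - g) / 2) = -(-1 : ℂ) ^ ((k - g) / 2) := by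
  rw [show k + 2 - g = (k - g) + 1 * 2 by ring, Int.add_mul_ediv_right _ _ two_ne_zero, zpow_add₀ (neg_ne_zero.2 one_ne_zero), zpow_one,
    mul_neg_one]

omit [Fintype ι] [FiniteDimensional ℂ E] [Nontrivial E] in
/-- **The graded Looijenga–Lunts form** `B_φ(w, w') = Σ_{k+l=N} ε(k) ⟨w_k, w'_l⟩_e` on `H•(X; ℂ)`: a bilinear form restricting to `ε(k) ⟨ , ⟩_e` on
complementary homogeneous components and to `0` on the others. [cite: LooijengaLunts1997, §1 (1.7) p. 6 ("φ(α, β) := (−1)^q ∫ α ∪ β")] -/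
private theorem exists_llPairing₇₅ (e : Fin N ≃ ι) :
    ∃ B : LinearMap.BilinForm ℂ (GForm E ℂ),
      (∀ (k l : ℕ) (h : k + l = N) (x : E [⋀^Fin k]→L[ℝ] ℂ) (y : E [⋀^Fin l]→L[ℝ] ℂ),
          B (GForm.of k x) (GForm.of l y) = (-1 : ℂ) ^ (((k : ℤ) - (finrank ℂ E : ℤ)) / 2) * poincarePairing Φ e h x y) ∧
      (∀ (k l : ℕ), k + l ≠ N → ∀ (x : E [⋀^Fin k]→L[ℝ] ℂ) (y : E [⋀^Fin l]→L[ℝ] ℂ), B (GForm.of k x) (GForm.of l y) = 0) := by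
  classical
  refine ⟨∑ k ∈ Finset.range (N + 1), ∑ l ∈ Finset.range (N + 1),
    if h : k + l = N then (-1 : ℂ) ^ (((k : ℤ) - (finrank ℂ E : ℤ)) / 2) •
      (poincarePairing Φ e h).compl₁₂ (LinearMap.proj (R := ℂ) (φ := fun m ↦ E [⋀^Fin m]→L[ℝ] ℂ) k)
      (LinearMap.proj (R := ℂ) (φ := fun m ↦ E [⋀^Fin m]→L[ℝ] ℂ) l) else 0, fun k l h x y ↦ ?_, fun k l hkl x y ↦ ?_⟩
  · simp only [LinearMap.sum_apply]
    rw [Finset.sum_eq_single_of_mem k (Finset.mem_range.2 (by omega)) fun k' _ hk' ↦ ?_]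
    · rw [Finset.sum_eq_single_of_mem l (Finset.mem_range.2 (by omega)) fun l' _ hl' ↦ ?_]
      · rw [dif_pos h, LinearMap.smul_apply, LinearMap.smul_apply, LinearMap.compl₁₂_apply, LinearMap.proj_apply, LinearMap.proj_apply,
          GForm.of_apply_self, GForm.of_apply_self, smul_eq_mul]
      · split_ifs with h'
        · rw [LinearMap.smul_apply, LinearMap.smul_apply, LinearMap.compl₁₂_apply, LinearMap.proj_apply, LinearMap.proj_apply,
            GForm.of_apply_of_ne hl', map_zero, smul_zero]
        · rw [LinearMap.zero_apply, LinearMap.zero_apply]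
    · refine Finset.sum_eq_zero fun l' _ ↦ ?_
      split_ifs with h'
      · rw [LinearMap.smul_apply, LinearMap.smul_apply, LinearMap.compl₁₂_apply, LinearMap.proj_apply, LinearMap.proj_apply,
          GForm.of_apply_of_ne hk', map_zero, LinearMap.zero_apply, smul_zero]
      · rw [LinearMap.zero_apply, LinearMap.zero_apply]
  · simp only [LinearMap.sum_apply]
    refine Finset.sum_eq_zero fun k' _ ↦ Finset.sum_eq_zero fun l' _ ↦ ?_
    split_ifs with h'
    · rw [LinearMap.smul_apply, LinearMap.smul_apply, LinearMap.compl₁₂_apply, LinearMap.proj_apply, LinearMap.proj_apply]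
      by_cases hk' : k' = k
      · subst hk'
        have hl' : l' ≠ l := fun hll ↦ hkl (hll ▸ h')
        rw [GForm.of_apply_of_ne hl', map_zero, smul_zero]
      · rw [GForm.of_apply_of_ne hk', map_zero, LinearMap.zero_apply, smul_zero]
    · rw [LinearMap.zero_apply, LinearMap.zero_apply]

omit [Fintype ι] [DecidableEq ι] [Nontrivial E] in
/-- An adjoint pair is detected on homogeneous elements. [folklore] -/
private theorem isAdjointPair_of_forall_of₇₅ {B : LinearMap.BilinForm ℂ (GForm E ℂ)} {S T : Module.End ℂ (GForm E ℂ)}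
    (hST : ∀ (a b : ℕ) (x : E [⋀^Fin a]→L[ℝ] ℂ) (y : E [⋀^Fin b]→L[ℝ] ℂ),
      B (S (GForm.of a x)) (GForm.of b y) = B (GForm.of a x) (T (GForm.of b y))) :
    LinearMap.IsAdjointPair B B S T := by
  intro w w'
  conv_lhs => rw [← sum_range_of_eq w, ← sum_range_of_eq w']
  conv_rhs => rw [← sum_range_of_eq w, ← sum_range_of_eq w']
  simp only [map_sum, LinearMap.sum_apply, hST]

omit [Nontrivial E] in
/-- **`h` and `L_η` are BOTH skew for `B_φ`**: `H` is skew for `⟨ , ⟩_e` on complementary degrees (g52-#3 `poincarePairing_countingG_skew`), and the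
cup-product self-adjointness `⟨L x, y⟩ = ⟨x, L y⟩` (`poincarePairing_lefschetzPow_one_comm`) becomes skewness because `ε(a + 2) = −ε(a)` —
"the fact that `φ` is killed by `e_a`". [cite: LooijengaLunts1997, §1 (1.6) Proposition (proof) and (1.7)] [cite: Andre1996Motifs, §1.1 (p. 11)] -/
private theorem exists_llPairing_skew_skew₇₅ (η : E [⋀^Fin 2]→L[ℝ] ℝ) (e : Fin N ≃ ι) :
    ∃ B : LinearMap.BilinForm ℂ (GForm E ℂ),
      (∀ (k l : ℕ) (h : k + l = N) (x : E [⋀^Fin k]→L[ℝ] ℂ) (y : E [⋀^Fin l]→L[ℝ] ℂ),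
          B (GForm.of k x) (GForm.of l y) = (-1 : ℂ) ^ (((k : ℤ) - (finrank ℂ E : ℤ)) / 2) * poincarePairing Φ e h x y) ∧
      (∀ (k l : ℕ), k + l ≠ N → ∀ (x : E [⋀^Fin k]→L[ℝ] ℂ) (y : E [⋀^Fin l]→L[ℝ] ℂ), B (GForm.of k x) (GForm.of l y) = 0) ∧
      B.IsSkewAdjoint (countingG E) ∧ B.IsSkewAdjoint (lefschetzG η) := by
  obtain ⟨B, hB, hB0⟩ := exists_llPairing₇₅ Φ e
  refine ⟨B, hB, hB0, ?_, ?_⟩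
  · change LinearMap.IsAdjointPair B B ⇑(countingG E) ⇑(-countingG E)
    refine isAdjointPair_of_forall_of₇₅ fun a b x y ↦ ?_
    rw [countingG_of, LinearMap.neg_apply, countingG_of, map_neg, ← GForm.of_smul, ← GForm.of_smul]
    by_cases h : a + b = N
    · rw [hB a b h, hB a b h, poincarePairing_countingG_skew Φ e h, mul_neg]
    · rw [hB0 a b h, hB0 a b h, neg_zero]
  · change LinearMap.IsAdjointPair B B ⇑(lefschetzG η) ⇑(-lefschetzG η)
    refine isAdjointPair_of_forall_of₇₅ fun a b x y ↦ ?_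
    rw [LinearMap.neg_apply, lefschetzG_of, lefschetzG_of, map_neg]
    by_cases h : (a + 2) + b = N
    · rw [hB _ _ h, hB _ _ (show a + (b + 2) = N by omega), poincarePairing_lefschetzPow_one_comm Φ η e h (by omega),
        Nat.cast_add, Nat.cast_two, neg_one_zpow_div_two_add_two, neg_mul]
    · rw [hB0 _ _ h, hB0 _ _ (show a + (b + 2) ≠ N by omega), neg_zero]

omit [Nontrivial E] in
/-- **`B_φ(of k x, w) = ε(k) ⟨x, w_{k'}⟩_e`** (`k + k' = N`). [cite: LooijengaLunts1997, §1 (1.7) p. 6] -/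
private theorem llPairing_of_apply₇₅ (e : Fin N ≃ ι) {B : LinearMap.BilinForm ℂ (GForm E ℂ)}
    (hB : ∀ (k l : ℕ) (h : k + l = N) (x : E [⋀^Fin k]→L[ℝ] ℂ) (y : E [⋀^Fin l]→L[ℝ] ℂ),
      B (GForm.of k x) (GForm.of l y) = (-1 : ℂ) ^ (((k : ℤ) - (finrank ℂ E : ℤ)) / 2) * poincarePairing Φ e h x y)
    (hB0 : ∀ (k l : ℕ), k + l ≠ N → ∀ (x : E [⋀^Fin k]→L[ℝ] ℂ) (y : E [⋀^Fin l]→L[ℝ] ℂ), B (GForm.of k x) (GForm.of l y) = 0)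
    {k k' : ℕ} (h : k + k' = N) (x : E [⋀^Fin k]→L[ℝ] ℂ) (w : GForm E ℂ) :
    B (GForm.of k x) w = (-1 : ℂ) ^ (((k : ℤ) - (finrank ℂ E : ℤ)) / 2) * poincarePairing Φ e h x (w k') := by
  have hN := finrank_complex_mul_two Φ e
  conv_lhs => rw [← sum_range_of_eq w]
  rw [map_sum, Finset.sum_eq_single_of_mem k' (Finset.mem_range.2 (by omega)) fun a _ ha ↦ ?_]
  · exact hB k k' h x (w k')
  · exact hB0 k a (by omega) x (w a)

omit [Nontrivial E] in
/-- **`B_φ(w, w') = Σ_{m ≤ N} ε(m) ⟨w_m, w'_{N−m}⟩_e`**. [cite: LooijengaLunts1997, §1 (1.7) p. 6] -/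
private theorem llPairing_eq_sum₇₅ (e : Fin N ≃ ι) {B : LinearMap.BilinForm ℂ (GForm E ℂ)}
    (hB : ∀ (k l : ℕ) (h : k + l = N) (x : E [⋀^Fin k]→L[ℝ] ℂ) (y : E [⋀^Fin l]→L[ℝ] ℂ),
      B (GForm.of k x) (GForm.of l y) = (-1 : ℂ) ^ (((k : ℤ) - (finrank ℂ E : ℤ)) / 2) * poincarePairing Φ e h x y)
    (hB0 : ∀ (k l : ℕ), k + l ≠ N → ∀ (x : E [⋀^Fin k]→L[ℝ] ℂ) (y : E [⋀^Fin l]→L[ℝ] ℂ), B (GForm.of k x) (GForm.of l y) = 0)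
    (w w' : GForm E ℂ) :
    B w w' = ∑ m : Fin (N + 1), (-1 : ℂ) ^ ((((m : ℕ) : ℤ) - (finrank ℂ E : ℤ)) / 2) *
      poincarePairing Φ e (show (m : ℕ) + (N - m) = N by omega) (w m) (w' (N - m)) := by
  have hN := finrank_complex_mul_two Φ e
  conv_lhs => rw [← sum_range_of_eq w]
  rw [map_sum, LinearMap.sum_apply, Finset.sum_range (fun a ↦ B (GForm.of a (w a)) w')]
  have hNg : 2 * finrank ℂ E = N := by omega
  subst hNg
  exact Finset.sum_congr rfl fun m _ ↦ llPairing_of_apply₇₅ Φ e hB hB0 (by omega) (w m) w'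

end Graded

/-! ## §1 `ρ(SL₂(ℂ))` preserves `φ` -/

section Invariant

/-- **LOOIJENGA–LUNTS' FORM IS `SL₂(ℂ)`-INVARIANT: `Σ_{m ≤ N} ε(m) ⟨(ρ(γ)(of k x))_m, (ρ(γ)(of l y))_{N−m}⟩_e = ε(k) ⟨x, y⟩_e`** for `x ∈ Hᵏ`,
`y ∈ Hˡ`, `k + l = N = 2g`, every `γ ∈ SL₂(ℂ)` and every non-degenerate `η`, where `ε(k) = (−1)^{⌊(k−g)/2⌋}` is the sign of "`φ(α, β) := (−1)^q ∫ α ∪ β`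
(`deg α = n + 2q` or `n + 2q + 1`)": `h` and `L_η` are `φ`-skew, so "`𝔤(𝔞, M)` is then a subalgebra of `aut(M, φ)`" and the group it generates —
Beauville's `exp(a L_η)`, `exp(a Λ_η)`, `ℱ` — consists of `φ`-isometries (abstract `sl2Rep_isOrthogonal`). [cite: LooijengaLunts1997, §1 (1.3) p. 5, (1.6), (1.7) p. 6]
[cite: Beauville2010SL2, §4 Theorem] [cite: Andre1996Motifs, §1.1–§1.2 (p. 11)] -/
theorem sum_llSign_mul_poincarePairing_sl2Rep_sl2Rep_eq (hη : ∀ v : E, v ≠ 0 → ∃ w : E, η ![v, w] ≠ 0) (e : Fin N ≃ ι) (γ : SL(2, ℂ))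
    {k l : ℕ} (h : k + l = N) (x : E [⋀^Fin k]→L[ℝ] ℂ) (y : E [⋀^Fin l]→L[ℝ] ℂ) :
    ∑ m : Fin (N + 1), (-1 : ℂ) ^ ((((m : ℕ) : ℤ) - (finrank ℂ E : ℤ)) / 2) *
        poincarePairing Φ e (show (m : ℕ) + (N - m) = N by omega)
          ((hasLefschetzProperty_lefschetzG hη).sl2Rep isZGrading_countingG γ (GForm.of k x) m)
          ((hasLefschetzProperty_lefschetzG hη).sl2Rep isZGrading_countingG γ (GForm.of l y) (N - m)) =
      (-1 : ℂ) ^ (((k : ℤ) - (finrank ℂ E : ℤ)) / 2) * poincarePairing Φ e h x y := by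
  obtain ⟨B, hB, hB0, hh, he⟩ := exists_llPairing_skew_skew₇₅ Φ η e
  have key := (hasLefschetzProperty_lefschetzG hη).sl2Rep_isOrthogonal isZGrading_countingG hh he γ (GForm.of k x) (GForm.of l y)
  rw [llPairing_eq_sum₇₅ Φ e hB hB0, hB k l h] at key
  exact key

/-- When `k + l ≠ N`: `Σ_m ε(m) ⟨(ρ(γ) x)_m, (ρ(γ) y)_{N−m}⟩_e = 0` (`= φ(x, y)`). [cite: LooijengaLunts1997, §1 (1.3) p. 5, (1.7) p. 6] -/
theorem sum_llSign_mul_poincarePairing_sl2Rep_sl2Rep_eq_zero (hη : ∀ v : E, v ≠ 0 → ∃ w : E, η ![v, w] ≠ 0) (e : Fin N ≃ ι) (γ : SL(2, ℂ))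
    {k l : ℕ} (h : k + l ≠ N) (x : E [⋀^Fin k]→L[ℝ] ℂ) (y : E [⋀^Fin l]→L[ℝ] ℂ) :
    ∑ m : Fin (N + 1), (-1 : ℂ) ^ ((((m : ℕ) : ℤ) - (finrank ℂ E : ℤ)) / 2) *
        poincarePairing Φ e (show (m : ℕ) + (N - m) = N by omega)
          ((hasLefschetzProperty_lefschetzG hη).sl2Rep isZGrading_countingG γ (GForm.of k x) m)
          ((hasLefschetzProperty_lefschetzG hη).sl2Rep isZGrading_countingG γ (GForm.of l y) (N - m)) = 0 := by
  obtain ⟨B, hB, hB0, hh, he⟩ := exists_llPairing_skew_skew₇₅ Φ η e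
  have key := (hasLefschetzProperty_lefschetzG hη).sl2Rep_isOrthogonal isZGrading_countingG hh he γ (GForm.of k x) (GForm.of l y)
  rw [llPairing_eq_sum₇₅ Φ e hB hB0, hB0 k l h] at key
  exact key

/-- The Weyl element `(0 −1 ; 1 0) ∈ SL₂(ℂ)`. [cite: Beauville2010SL2, §2] -/
private theorem det_weyl₇₅ : Matrix.det !![(0 : ℂ), -1; 1, 0] = 1 := by
  simp [Matrix.det_fin_two_of]

/-- **The Weyl operator (`= ±χ⁻¹ φ_H^*ℱ`, the normalised Fourier transform) is a `φ`-isometry**, graded form: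
`Σ_m ε(m) ⟨(w(of k x))_m, (w(of l y))_{N−m}⟩_e = ε(k) ⟨x, y⟩_e` (`k + l = N`). [cite: LooijengaLunts1997, §1 (1.3) p. 5, (1.7) p. 6]
[cite: Beauville2010SL2, §4 Theorem ("(0 −1 ; 1 0)·z = ℱ(z)")] -/
theorem sum_llSign_mul_poincarePairing_weylOperator_weylOperator_eq (hη : ∀ v : E, v ≠ 0 → ∃ w : E, η ![v, w] ≠ 0) (e : Fin N ≃ ι)
    {k l : ℕ} (h : k + l = N) (x : E [⋀^Fin k]→L[ℝ] ℂ) (y : E [⋀^Fin l]→L[ℝ] ℂ) :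
    ∑ m : Fin (N + 1), (-1 : ℂ) ^ ((((m : ℕ) : ℤ) - (finrank ℂ E : ℤ)) / 2) *
        poincarePairing Φ e (show (m : ℕ) + (N - m) = N by omega)
          ((hasLefschetzProperty_lefschetzG hη).weylOperator isZGrading_countingG (GForm.of k x) m)
          ((hasLefschetzProperty_lefschetzG hη).weylOperator isZGrading_countingG (GForm.of l y) (N - m)) =
      (-1 : ℂ) ^ (((k : ℤ) - (finrank ℂ E : ℤ)) / 2) * poincarePairing Φ e h x y := by
  rw [← (hasLefschetzProperty_lefschetzG hη).sl2Rep_apply_of_coe_eq_weyl isZGrading_countingG ⟨_, det_weyl₇₅⟩ rfl]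
  exact sum_llSign_mul_poincarePairing_sl2Rep_sl2Rep_eq Φ hη e _ h x y

/-- **`ε(2g − k) ⟨w(x)_{2g−k}, w(y)_{2g−l}⟩_e = ε(k) ⟨x, y⟩_e`** (`k + l = N`, `x ∈ Hᵏ`, `y ∈ Hˡ`): `w` is homogeneous (`w(Hᵏ) ⊆ H^{2g−k}`), so only one
term of the graded sum survives — the Parseval identity of g52-#3 in Looijenga–Lunts' normalisation. [cite: LooijengaLunts1997, §1 (1.7) p. 6]
[cite: Lange2023AbelianVarietiesComplex, §6.2.4 Prop. 6.2.20 (pp. 310–311, Parseval)] -/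
theorem llSign_mul_poincarePairing_weylOperator_weylOperator (hη : ∀ v : E, v ≠ 0 → ∃ w : E, η ![v, w] ≠ 0) (e : Fin N ≃ ι)
    {k l : ℕ} (h : k + l = N) (h' : l + k = N) (x : E [⋀^Fin k]→L[ℝ] ℂ) (y : E [⋀^Fin l]→L[ℝ] ℂ) :
    (-1 : ℂ) ^ (((l : ℤ) - (finrank ℂ E : ℤ)) / 2) *
        poincarePairing Φ e h' ((hasLefschetzProperty_lefschetzG hη).weylOperator isZGrading_countingG (GForm.of k x) l)
          ((hasLefschetzProperty_lefschetzG hη).weylOperator isZGrading_countingG (GForm.of l y) k) =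
      (-1 : ℂ) ^ (((k : ℤ) - (finrank ℂ E : ℤ)) / 2) * poincarePairing Φ e h x y := by
  have hN := finrank_complex_mul_two Φ e
  obtain rfl : k = N - l := by omega
  rw [← sum_llSign_mul_poincarePairing_weylOperator_weylOperator_eq Φ hη e h x y,
    Finset.sum_eq_single_of_mem (⟨l, by omega⟩ : Fin (N + 1)) (Finset.mem_univ _) fun m _ hm ↦ ?_]
  -- (the surviving term `m = l` closes by `rfl`); all other components of `w(of (N − l) x)` vanish: it is homogeneous of degree `l`
  have hml : (m : ℕ) ≠ l := fun hc ↦ hm (Fin.ext hc)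
  rw [(isHomog_weylOperator_of hη (show N - l + l = 2 * finrank ℂ E by omega) x) m hml, map_zero, LinearMap.zero_apply, mul_zero]

end Invariant

end ComplexTorus

end Literature.Geometry.Kaehler

end
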